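import Summits.AnomalousDissipation.AnomalousDissipation.Theorems.TwoAndHalfDTwohalfdThesisStubWeakDuhamel
import Summits.AnomalousDissipation.AnomalousDissipation.Theorems.TwoAndHalfDTwohalfdThesisStubDuhamelVariance
import Summits.AnomalousDissipation.AnomalousDissipation.Theorems.TwoAndHalfDTwohalfdThesisStubGlobalRelease
import Summits.AnomalousDissipation.AnomalousDissipation.Theorems.TwoAndHalfDTwohalfdThesisStubFixedViscosityEnvelope
import Summits.AnomalousDissipation.AnomalousDissipation.Theorems.TwoAndHalfDTwohalfdThesisWOfProfileMixer
import Literature.Analysis.FluidPDE.LongTimeAverageShift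
import Literature.Analysis.FluidPDE.LongTimeAverageSlidingWindow
import Mathlib.MeasureTheory.Integral.ExpDecay

/-!
# Q2 `stub_envelopedSourceVariance` — Duhamel with datum: enveloped releases of a steady source cap
# the `limsup`-mean variance (line `Sketch`, crux stmt-AnomalousDissipation-0206)

Registered tool stub (section Q, selectivity of the witness's mixing) of the line `Sketch`
(duhamel-release) for the crux
`Summit.AnomalousDissipation.AnomalousDissipation.Theses.TwoAndHalfD.TwohalfdThesis`
(stmt-AnomalousDissipation-0206).

CONTENT.  Let `κ > 0`, `G` smooth, `ω` a classical solution of `∂ₜω + u·∇ω = κΔω + G` on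
`[0, ∞) × T²` whose slice `ω(s₀)` (`s₀ ≥ 0`) has zero mean, and let the classical releases `ψ s` of
`G` at every `s ≥ s₀` obey `‖ψ s (t)‖² ≤ Λ(t−s)²‖G‖²` (`s₀ ≤ s ≤ t`) with `Λ ≥ 0`, `∫₀^∞ Λ ≤ M`.
Then `⟨‖ω‖²⟩ ≤ M²‖G‖²`, `⟨·⟩ = limsup` of the running means (`longTimeAvgSup`).

PROOF.
* `envSrc_integral_add_sq_le` — Minkowski in `L²(T^d)` squared: `∫ f² ≤ a²`, `∫ g² ≤ b²` give
  `∫ (f+g)² ≤ (a+b)²` (the tree's `ColdStartVariance.sqrt_integral_add_sq_le`).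
* `envSrc_longTimeAvgSup_le_of_transient` — Cesàro bookkeeping: if `0 ≤ g ≤ K + f` on `[0, ∞)`
  with `f ≥ 0` integrable on `(0, ∞)`, then `⟨g⟩ ≤ K` (`∫₀ᵀ g ≤ K T + ∫₀^∞ f`, so the running means
  are eventually `≤ K + ε`; `longTimeAvgSup_le_of_eventually_le`, `ε ↓ 0`).
* `envSrc_longTimeAvgSup_le_of_zero_spinup` — the case `s₀ = 0`: release the datum, `R` := the
  global classical solution of the unforced equation with `R 0 = ω 0` (`stub_globalRelease`);
  `θ := ω − R` solves the sourced equation on `[0, ∞)` with the cold start `θ 0 = 0`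
  (`ColdStartVariance.forced_sub_unforced`), so D0 `stub_weakDuhamel` + D1 `stub_duhamelVariance`
  (spin-up `0`) give `‖θ(t)‖² ≤ M²‖G‖²`, while the transient dies,
  `‖R(t)‖² ≤ e^{−8π²κt}‖ω(0)‖²` (`stub_fixedViscosityEnvelope`); Minkowski gives
  `‖ω(t)‖² ≤ (M‖G‖ + e^{−4π²κt}‖ω(0)‖)² = M²‖G‖² + f(t)` with `f` a sum of two decaying
  exponentials, integrable on `(0, ∞)` (Mathlib `exp_neg_integrableOn_Ioi`).
* `stub_envelopedSourceVariance` — the general `s₀ ≥ 0`: `⟨‖ω‖²⟩ = ⟨‖ω(· + s₀)‖²⟩`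
  (`longTimeAvgSup_comp_add_right`; `t ↦ ‖ω(t)‖²` is continuous on `[0, ∞)`), and the translates
  `ω(· + s₀)`, `u(· + s₀)`, `ψ (s + s₀) (· + s₀)` satisfy the hypotheses of the case `s₀ = 0`
  (`isClassicalScalarTransportForcedOn_comp_add_const`, `isClassicalScalarTransportOn_comp_add_const`,
  `ColdStartVariance.forced_restrict`).
Supports stmt-AnomalousDissipation-0206. [folklore: Duhamel's principle, Evans 2010, §2.3.1 (c);
Doering–Foias 2002, §2 (long-time averages)]

## Mathlib / Literature search

`lean search 'longTimeAvgSup_'` (`LongTimeAverageSubadditive`, `LongTimeAverageSlidingWindow`,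
`LongTimeAverageShift.longTimeAvgSup_comp_add_right`; `…ShellPincer.longTimeAvgSup_exp_eq_zero` is the
special case `K = 0`, `f = C e^{-ct}` of the bookkeeping lemma, in a heavy Galerkin module — not
imported), `'forced_sub_unforced|forced_restrict|sqrt_integral_add_sq_le'` (`…ColdStartVarianceToolkit`),
`'exp_neg_integrableOn_Ioi'` (Mathlib `MeasureTheory.Integral.ExpDecay`). `lean find 'longTimeAvg'`:
nothing to adapt.
-/

noncomputable section

-- the summit path `AnomalousDissipation/AnomalousDissipation` duplicates a namespace component
set_option linter.dupNamespace false

namespace Summit.AnomalousDissipation.AnomalousDissipation.Theorems.TwohalfdThesis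

open MeasureTheory Set Filter Topology
open scoped ENNReal NNReal InnerProductSpace
open Literature.Analysis.FunctionSpaces Literature.Analysis.FluidPDE
open Summit.AnomalousDissipation.AnomalousDissipation.Theorems.ScalarAnomalySteadySourceFormal.ColdStartVariance

/-! ## Minkowski, squared -/

/-- **Minkowski in `L²(T^d)`, squared form.** For continuous `f g` with `∫ f² ≤ a²`, `∫ g² ≤ b²`
(`a, b ≥ 0`): `∫ (f + g)² ≤ (a + b)²` (`sqrt_integral_add_sq_le` and monotonicity of squares).
[folklore] -/
theorem envSrc_integral_add_sq_le {d : Type*} [Fintype d] {f g : UnitAddTorus d → ℝ}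
    (hf : Continuous f) (hg : Continuous g) {a b : ℝ} (ha : 0 ≤ a) (hb : 0 ≤ b)
    (hfa : ∫ x, f x ^ 2 ≤ a ^ 2) (hgb : ∫ x, g x ^ 2 ≤ b ^ 2) :
    ∫ x, (f x + g x) ^ 2 ≤ (a + b) ^ 2 := by
  have h1 := sqrt_integral_add_sq_le hf hg
  have h2 : Real.sqrt (∫ x, f x ^ 2) ≤ a := (Real.sqrt_le_sqrt hfa).trans_eq (Real.sqrt_sq ha)
  have h3 : Real.sqrt (∫ x, g x ^ 2) ≤ b := (Real.sqrt_le_sqrt hgb).trans_eq (Real.sqrt_sq hb)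
  have h4 : Real.sqrt (∫ x, (f x + g x) ^ 2) ≤ a + b := h1.trans (add_le_add h2 h3)
  have h0 : 0 ≤ ∫ x, (f x + g x) ^ 2 := integral_nonneg fun _ => sq_nonneg _
  calc ∫ x, (f x + g x) ^ 2 = (Real.sqrt (∫ x, (f x + g x) ^ 2)) ^ 2 := (Real.sq_sqrt h0).symm
    _ ≤ (a + b) ^ 2 := pow_le_pow_left₀ (Real.sqrt_nonneg _) h4 2

/-! ## Cesàro bookkeeping: a constant plus an integrable transient -/

/-- **Running means forget an integrable transient.** If `0 ≤ g ≤ K + f` on `[0, ∞)`, `g` interval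
integrable on every `[0, T]`, and `f ≥ 0` is integrable on `(0, ∞)`, then `⟨g⟩ ≤ K`
(`⟨g⟩ = limsup_T T⁻¹∫₀ᵀ g`): `∫₀ᵀ g ≤ K T + ∫_{(0,∞)} f`, so the running means are eventually
`≤ K + ε` for every `ε > 0` (`longTimeAvgSup_le_of_eventually_le`). [folklore] -/
theorem envSrc_longTimeAvgSup_le_of_transient {g f : ℝ → ℝ} {K : ℝ} (hg0 : ∀ t, 0 ≤ g t)
    (hgi : ∀ T, 0 < T → IntervalIntegrable g volume 0 T) (hf0 : ∀ t, 0 ≤ f t)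
    (hfi : IntegrableOn f (Ioi 0)) (hle : ∀ t, 0 ≤ t → g t ≤ K + f t) :
    longTimeAvgSup g ≤ K := by
  set I : ℝ := ∫ t in Ioi 0, f t with hI
  have hI0 : 0 ≤ I := setIntegral_nonneg measurableSet_Ioi fun t _ => hf0 t
  -- the integrated bound `∫₀ᵀ g ≤ K T + I`
  have hint : ∀ T, 0 < T → ∫ t in (0 : ℝ)..T, g t ≤ K * T + I := by
    intro T hT
    have hfT : IntervalIntegrable f volume 0 T :=
      (intervalIntegrable_iff_integrableOn_Ioc_of_le hT.le).2 (hfi.mono_set Ioc_subset_Ioi_self)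
    have h1 : ∫ t in (0 : ℝ)..T, g t ≤ ∫ t in (0 : ℝ)..T, (K + f t) :=
      intervalIntegral.integral_mono_on hT.le (hgi T hT) (intervalIntegrable_const.add hfT)
        fun t ht => hle t ht.1
    have h2 : ∫ t in (0 : ℝ)..T, (K + f t) = K * T + ∫ t in (0 : ℝ)..T, f t := by
      rw [intervalIntegral.integral_add intervalIntegrable_const hfT, intervalIntegral.integral_const,
        smul_eq_mul, sub_zero, mul_comm]
    have h3 : ∫ t in (0 : ℝ)..T, f t ≤ I := by
      rw [intervalIntegral.integral_of_le hT.le]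
      exact setIntegral_mono_set hfi (ae_of_all _ fun t => hf0 t) (ae_of_all _ Ioc_subset_Ioi_self)
    linarith
  -- the running means are eventually `≤ K + ε`
  refine le_of_forall_pos_le_add fun ε hε => ?_
  refine longTimeAvgSup_le_of_eventually_le hg0 ?_
  filter_upwards [eventually_ge_atTop (max 1 (I / ε))] with T hT
  have hT1 : 1 ≤ T := (le_max_left _ _).trans hT
  have hT0 : 0 < T := one_pos.trans_le hT1
  have hIT : I ≤ ε * T := by
    have h := (le_max_right _ _).trans hT
    rw [div_le_iff₀ hε] at h
    linarith
  unfold timeMean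
  calc T⁻¹ * ∫ t in (0 : ℝ)..T, g t ≤ T⁻¹ * (K * T + I) :=
        mul_le_mul_of_nonneg_left (hint T hT0) (inv_nonneg.2 hT0.le)
    _ ≤ T⁻¹ * (K * T + ε * T) := mul_le_mul_of_nonneg_left (by linarith) (inv_nonneg.2 hT0.le)
    _ = K + ε := by field_simp

/-! ## The case of zero spin-up -/

/-- **Enveloped-source variance bound, spin-up `0`.** Let `κ > 0`, `G` smooth, `ω` a classical
solution of `∂ₜω + u·∇ω = κΔω + G` on `[0, ∞) × T²` with `∫ ω(0) = 0`, and let the classical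
releases `ψ s` of `G` from every `s ≥ 0` obey `‖ψ s (t)‖² ≤ Λ(t-s)²‖G‖²` (`0 ≤ s ≤ t`), `Λ ≥ 0`
integrable on `[0, ∞)` with `∫ Λ ≤ M`. Then `⟨‖ω‖²⟩ ≤ M²‖G‖²`. Release the datum
(`stub_globalRelease`, transient `stub_fixedViscosityEnvelope`), bound the cold-start remainder by
D0 `stub_weakDuhamel` + D1 `stub_duhamelVariance`, recombine by Minkowski and average
(`envSrc_longTimeAvgSup_le_of_transient`). [folklore] -/
theorem envSrc_longTimeAvgSup_le_of_zero_spinup {κ M : ℝ}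
    {u : ℝ → UnitAddTorus (Fin 2) → EuclideanSpace ℝ (Fin 2)} {G : UnitAddTorus (Fin 2) → ℝ}
    {ω : ℝ → UnitAddTorus (Fin 2) → ℝ} {ψ : ℝ → ℝ → UnitAddTorus (Fin 2) → ℝ} {Λ : ℝ → ℝ}
    (hκ : 0 < κ) (hG : Torus.IsSmooth G)
    (hω : Torus.IsClassicalScalarTransportForcedOn (Ici 0) κ u (fun _ => G) ω)
    (hω0 : Torus.HasZeroMean (ω 0))
    (hψ : ∀ s, 0 ≤ s → Torus.IsClassicalScalarTransportOn (Ici s) κ u (ψ s) ∧ ψ s s = G)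
    (hΛ : ∀ τ, 0 ≤ Λ τ) (hΛi : IntegrableOn Λ (Ici 0)) (hM : ∫ τ in Ici 0, Λ τ ≤ M)
    (henv : ∀ s t, 0 ≤ s → s ≤ t → Torus.scalarL2Sq (ψ s t) ≤ Λ (t - s) ^ 2 * Torus.scalarL2Sq G) :
    longTimeAvgSup (fun t => Torus.scalarL2Sq (ω t)) ≤ M ^ 2 * Torus.scalarL2Sq G := by
  -- (1) release the datum
  have hω0s : Torus.IsSmooth (ω 0) := hω.smooth_scalar.isSmooth_slice (mem_Ici.2 le_rfl)
  obtain ⟨R, hR, hR0⟩ :=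
    stub_globalRelease κ 0 u (ω 0) hκ le_rfl hω.smooth_velocity hω.divFree hω0s
  -- (2) the cold-start remainder `θ = ω - R`
  set θ : ℝ → UnitAddTorus (Fin 2) → ℝ := fun t x => ω t x - R t x with hθ_def
  have hθ : Torus.IsClassicalScalarTransportForcedOn (Ici 0) κ u (fun _ => G) θ :=
    forced_sub_unforced (uniqueDiffOn_Ici 0) hω hR
  have hθ0 : θ 0 = fun _ => (0 : ℝ) := by
    funext x
    simp [hθ_def, hR0]
  -- (3) Duhamel: D0 then D1 with spin-up `0`
  have hD0 := stub_weakDuhamel κ u G θ ψ hκ hG hθ hθ0 hψ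
  have hD1 := stub_duhamelVariance κ 0 M u G θ ψ Λ hκ.le hG hθ hψ hD0 le_rfl hΛ hΛi hM henv
  -- (4) the transient
  have hRdec := stub_fixedViscosityEnvelope κ 0 u (ω 0) R hκ hω0s hω0 hR hR0
  -- constants
  set N : ℝ := Torus.scalarL2Sq G with hN
  set A : ℝ := Real.sqrt (Torus.scalarL2Sq (ω 0)) with hA_def
  set B : ℝ := Real.sqrt (M ^ 2 * N) with hB_def
  set c : ℝ := 4 * Real.pi ^ 2 * κ with hc_def
  have hc : 0 < c := by positivity
  have hA : 0 ≤ A := Real.sqrt_nonneg _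
  have hB : 0 ≤ B := Real.sqrt_nonneg _
  have hB2 : B ^ 2 = M ^ 2 * N :=
    Real.sq_sqrt (mul_nonneg (sq_nonneg _) (Torus.scalarL2Sq_nonneg _))
  have hexp2 : ∀ t, Real.exp (-(2 * c) * t) = Real.exp (-c * t) ^ 2 := fun t => by
    rw [sq, ← Real.exp_add]; ring_nf
  -- (5) the pointwise bound on `[0, ∞)`
  set f : ℝ → ℝ := fun t => 2 * B * A * Real.exp (-c * t) + A ^ 2 * Real.exp (-(2 * c) * t)
    with hf_def
  have hpt : ∀ t, 0 ≤ t → Torus.scalarL2Sq (ω t) ≤ B ^ 2 + f t := by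
    intro t ht
    have hRt : Torus.IsSmooth (R t) := hR.smooth_scalar.isSmooth_slice (mem_Ici.2 ht)
    have hθt : Torus.IsSmooth (θ t) := hθ.smooth_scalar.isSmooth_slice (mem_Ici.2 ht)
    have ha2 : ∫ x, R t x ^ 2 ≤ (A * Real.exp (-c * t)) ^ 2 := by
      have h1 := hRdec t ht
      rw [sub_zero] at h1
      calc ∫ x, R t x ^ 2 = Torus.scalarL2Sq (R t) := rfl
        _ ≤ Real.exp (-(8 * Real.pi ^ 2 * κ) * t) * Torus.scalarL2Sq (ω 0) := h1
        _ = (A * Real.exp (-c * t)) ^ 2 := by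
            rw [mul_pow, hA_def, Real.sq_sqrt (Torus.scalarL2Sq_nonneg _), ← hexp2, hc_def]
            ring_nf
    have hb2 : ∫ x, θ t x ^ 2 ≤ B ^ 2 := by
      rw [hB2]
      have h := hD1 t ht
      rwa [zero_add] at h
    have hsum : ∫ x, (R t x + θ t x) ^ 2 ≤ (A * Real.exp (-c * t) + B) ^ 2 :=
      envSrc_integral_add_sq_le hRt.continuous hθt.continuous (by positivity) hB ha2 hb2
    have heq : Torus.scalarL2Sq (ω t) = ∫ x, (R t x + θ t x) ^ 2 := by
      simp only [Torus.scalarL2Sq, hθ_def, add_sub_cancel]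
    rw [heq]
    calc ∫ x, (R t x + θ t x) ^ 2 ≤ (A * Real.exp (-c * t) + B) ^ 2 := hsum
      _ = B ^ 2 + f t := by
          show _ = B ^ 2 + (2 * B * A * Real.exp (-c * t) + A ^ 2 * Real.exp (-(2 * c) * t))
          rw [hexp2]; ring
  -- (6) the transient is nonnegative and integrable on `(0, ∞)`
  have hf0 : ∀ t, 0 ≤ f t := fun t => by positivity
  have hfi : IntegrableOn f (Ioi 0) :=
    ((exp_neg_integrableOn_Ioi 0 hc).const_mul (2 * B * A)).add
      ((exp_neg_integrableOn_Ioi 0 (by positivity : 0 < 2 * c)).const_mul (A ^ 2))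
  -- (7) local integrability of `t ↦ ‖ω(t)‖²` and the conclusion
  have hcont : ContinuousOn (fun t => Torus.scalarL2Sq (ω t)) (Ici 0) := by
    refine ((hω.smooth_scalar.mul hω.smooth_scalar).continuousOn_integral (convex_Ici 0)).congr
      fun t _ => ?_
    simp only [Torus.scalarL2Sq, sq]
  have hgi : ∀ T, 0 < T → IntervalIntegrable (fun t => Torus.scalarL2Sq (ω t)) volume 0 T :=
    fun T hT => (hcont.mono (by rw [uIcc_of_le hT.le]; exact Icc_subset_Ici_self)).intervalIntegrable
  rw [← hB2]
  exact envSrc_longTimeAvgSup_le_of_transient (fun t => Torus.scalarL2Sq_nonneg _) hgi hf0 hfi hpt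

/-! ## The stub -/

/-- **Q2 `stub_envelopedSourceVariance` (line `Sketch` = duhamel-release, crux
`TwoAndHalfD.TwohalfdThesis`) — DUHAMEL WITH DATUM: enveloped releases of a steady source cap the
`limsup`-mean variance.** Let `κ > 0`, `G` smooth, `ω` a classical solution of
`∂ₜω + u·∇ω = κΔω + G` on `[0, ∞) × T²` whose slice `ω(s₀)` (`s₀ ≥ 0`) has zero mean, and let the
classical releases `ψ s` of `G` at every `s ≥ s₀` obey `‖ψ s (t)‖² ≤ Λ(t−s)²‖G‖²` (`s₀ ≤ s ≤ t`)
with `Λ ≥ 0`, `∫₀^∞ Λ ≤ M`. Then `⟨‖ω‖²⟩ ≤ M²‖G‖²` (honest `limsup` running mean). The spin-up is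
cosmetic: `⟨‖ω‖²⟩ = ⟨‖ω(· + s₀)‖²⟩` (`longTimeAvgSup_comp_add_right`) and the translates by `s₀`
satisfy the hypotheses of `envSrc_longTimeAvgSup_le_of_zero_spinup`. [folklore] -/
theorem stub_envelopedSourceVariance :
    ∀ (κ s₀ M : ℝ) (u : ℝ → (UnitAddTorus (Fin 2)) → (EuclideanSpace ℝ (Fin 2))) (G : (UnitAddTorus (Fin 2)) → ℝ)
      (ω : ℝ → (UnitAddTorus (Fin 2)) → ℝ) (ψ : ℝ → ℝ → (UnitAddTorus (Fin 2)) → ℝ) (Λ : ℝ → ℝ),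
      0 < κ → Torus.IsSmooth G → 0 ≤ s₀ →
      Torus.IsClassicalScalarTransportForcedOn (Ici 0) κ u (fun _ => G) ω →
      Torus.HasZeroMean (ω s₀) →
      (∀ s, s₀ ≤ s → Torus.IsClassicalScalarTransportOn (Ici s) κ u (ψ s) ∧ ψ s s = G) →
      (∀ τ, 0 ≤ Λ τ) → IntegrableOn Λ (Ici 0) → (∫ τ in Ici 0, Λ τ) ≤ M →
      (∀ s t, s₀ ≤ s → s ≤ t → Torus.scalarL2Sq (ψ s t) ≤ Λ (t - s) ^ 2 * Torus.scalarL2Sq G) →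
      longTimeAvgSup (fun t => Torus.scalarL2Sq (ω t)) ≤ M ^ 2 * Torus.scalarL2Sq G := by
  intro κ s₀ M u G ω ψ Λ hκ hG hs₀ hω hω0 hψ hΛ hΛi hM henv
  -- `t ↦ ‖ω(t)‖²` is continuous on `[0, ∞)`, so its long-time average does not see the shift
  have hcont : ContinuousOn (fun t => Torus.scalarL2Sq (ω t)) (Ici 0) := by
    refine ((hω.smooth_scalar.mul hω.smooth_scalar).continuousOn_integral (convex_Ici 0)).congr
      fun t _ => ?_
    simp only [Torus.scalarL2Sq, sq]
  have hgi : ∀ a b, 0 ≤ a → a ≤ b →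
      IntervalIntegrable (fun t => Torus.scalarL2Sq (ω t)) volume a b := fun a b ha hab =>
    (hcont.mono (by rw [uIcc_of_le hab]; exact fun t ht => ha.trans ht.1)).intervalIntegrable
  rw [← longTimeAvgSup_comp_add_right (fun t => Torus.scalarL2Sq_nonneg (ω t)) hs₀ hgi]
  -- the translated solution on `[0, ∞)`
  have hω' : Torus.IsClassicalScalarTransportForcedOn (Ici 0) κ (fun t => u (t + s₀)) (fun _ => G)
      (fun t => ω (t + s₀)) := by
    have h1 := isClassicalScalarTransportForcedOn_comp_add_const hω s₀
    have hsub : Ici (0 : ℝ) ⊆ (· + s₀) ⁻¹' Ici 0 := fun t ht =>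
      mem_preimage.2 (mem_Ici.2 (add_nonneg (mem_Ici.1 ht) hs₀))
    exact forced_restrict h1 hsub (uniqueDiffOn_Ici 0)
  -- the translated releases
  have hψ' : ∀ s, 0 ≤ s → Torus.IsClassicalScalarTransportOn (Ici s) κ (fun t => u (t + s₀))
      (fun t => ψ (s + s₀) (t + s₀)) ∧ ψ (s + s₀) (s + s₀) = G := by
    intro s hs
    have hs' : s₀ ≤ s + s₀ := le_add_of_nonneg_left hs
    refine ⟨?_, (hψ (s + s₀) hs').2⟩
    have h2 := isClassicalScalarTransportOn_comp_add_const (hψ (s + s₀) hs').1 s₀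
    rw [Set.preimage_add_const_Ici, add_sub_cancel_right] at h2
    exact h2
  have henv' : ∀ s t, 0 ≤ s → s ≤ t →
      Torus.scalarL2Sq (ψ (s + s₀) (t + s₀)) ≤ Λ (t - s) ^ 2 * Torus.scalarL2Sq G := by
    intro s t hs hst
    have h := henv (s + s₀) (t + s₀) (le_add_of_nonneg_left hs) (by linarith)
    rwa [add_sub_add_right_eq_sub] at h
  have hω0' : Torus.HasZeroMean ((fun t => ω (t + s₀)) 0) := by
    show Torus.HasZeroMean (ω (0 + s₀))
    rw [zero_add]
    exact hω0
  exact envSrc_longTimeAvgSup_le_of_zero_spinup hκ hG hω' hω0' hψ' hΛ hΛi hM henv'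

end Summit.AnomalousDissipation.AnomalousDissipation.Theorems.TwohalfdThesis

end
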